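import Literature.NumberTheory.Transcendental.KZNoriSymbol
import Literature.NumberTheory.Transcendental.KZCalculusProofs
import Literature.NumberTheory.Transcendental.KZKernelConjectureForms
import Summits.KontsevichZagierPeriods.KontsevichZagierPeriods.Statement
import HarnessLib

/-!
# `DegreeEquality` (stmt-KontsevichZagierPeriods-6960, route HodgeColevel, informal crux r7) —
# negative side: the zero-symbol layer of the conjecture IS faithfulness of the Nori symbol

Refuter crux-attack evidence (classify, do not prove). The crux is informal: "for every integral
representation `r`, `deg_KZ(r) = L(Ψ[r])`", `L` = Hodge co-level of the Nori symbol (D3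
`HodgeColevelFiltration` does not exist; D2 `KZ.noriSymbol` exists as the HYPOTHESIS structure
`KZ.NoriSymbolData R B σ`; D1 `KZ.degree` exists). Whatever subspaces `C_k ⊆ 𝒫̃⁺` D3 delivers,
`0 ∈ C_0`, so `L(0) = 0` and the conjecture CONTAINS its zero-symbol layer

  `∀ r, Ψ[r] = 0 → KZ.degree r = 0`   ("ZeroSymbolLayer Ψ" below, always written out).

Proved here, sorry-free, for every symbol data `Ψ` over every relative period datum `(R, B, σ)`:

* `zeroSymbolLayer_iff_isFaithful` : `ZeroSymbolLayer Ψ ↔ Ψ.IsFaithful` (`ker Ψ = KZ.relations`,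
  thesis (b) of route VeryGoodTransfer; "not a result in print", Huber–Müller-Stach draft III
  Rem. 12.1.7). Ingredients: every formal combination is `[r] − [r']` modulo the moves
  (`KZ.exists_integralRep_sub_holds`), merging (`exists_of_add_of_sub_of_mem_relations`),
  `[r] + [−r] ∈ relations`, and: a `0`-dimensional representation of value `0` is null.
* `pointLayer_iff_isFaithful` : the same for the layer at ANY `0`-dimensional (Artin) symbol
  `Ψ[p]`, `p : IntegralRep 0` — so the repair "exclude the zero symbol / state it for `x ≠ 0`"
  changes nothing (degree-`0` witnesses of a non-zero constant are literally that constant).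
* `zeroSymbolLayer_of_summit` : the summit `KontsevichZagierPeriods` implies the layer (for every
  `Ψ`), via the kernel form `KZKernelConjecture` (`kzKernelConjecture_iff_isRational`).
* `summit_of_zeroSymbolLayer` : the layer for ONE `Ψ` plus Kontsevich's formal period conjecture
  `FormalPeriodEvalInjective R B σ` implies the summit (`kernel_subset_relations_of_isFaithful`).

Reading for the planner (restates-the-target check): the `L = 0`, symbol-`0` corner of
`DegreeEquality` is already "Conjecture 1 modulo the formal period conjecture"; the crux is not
cheaper than the summit it is meant to cut, independently of how D3 is written. Side results:
`reachable_iff_degree_le` (reachable dimensions are an up-set, by slabs — the fact the glue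
`DegreeEquality ∧ ValueDeterminesColevel → DegreeCompression` uses), `degree_eq_zero_of_dim_zero`
(the `n = 0` layer reads `0 = 0`), `degree_eq_zero_of_of_mem_relations` (null representations —
in particular `Ψ`-preimages of `0` that ARE relations — have degree `0`, consistent with `L(0)=0`).

Sources: M. Kontsevich, D. Zagier, *Periods* (2001), §1.2 (Conjecture 1, Problem 2);
A. Huber, S. Müller-Stach, *Periods and Nori Motives* (2017), §13.1–13.2 (draft III Rem. 12.1.7).
-/

noncomputable section

open MeasureTheory Set
open Literature.NumberTheory.Transcendental Literature.NumberTheory.Transcendental.KZ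

namespace Summit.KontsevichZagierPeriods.Theorems.DegreeEquality.Negative

variable {n m : ℕ}

/-! ## §1 Reachable dimensions, the dimension-zero layer, null representations -/

/-- Reachable dimensions form an up-set (raise the dimension by slabs,
`IntegralRep.exists_equivalent_of_le`). [folklore] -/
theorem reachable_of_le {r : IntegralRep n} {k k' : ℕ} (hk : Reachable r k) (h : k ≤ k') :
    Reachable r k' := by
  obtain ⟨s, hs⟩ := hk
  obtain ⟨R, hR⟩ := s.exists_equivalent_of_le h
  exact ⟨R, hs.trans hR⟩

/-- `r` reaches dimension `k` iff `KZ.degree r ≤ k`. [folklore] -/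
theorem reachable_iff_degree_le (r : IntegralRep n) (k : ℕ) : Reachable r k ↔ degree r ≤ k :=
  ⟨degree_le_of_reachable, fun h => reachable_of_le (degree_spec r) h⟩

/-- The `n = 0` layer of `DegreeEquality` reads `0 = 0` on the degree side. [folklore] -/
theorem degree_eq_zero_of_dim_zero (r : IntegralRep 0) : degree r = 0 :=
  Nat.le_zero.mp (degree_le r)

/-- A null representation (`[r] ∈ relations`) has degree `0`: it is equivalent to the empty
`0`-dimensional representation. [folklore] -/
theorem degree_eq_zero_of_of_mem_relations {r : IntegralRep n} (h : of r ∈ relations) :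
    degree r = 0 := by
  have h' : Equivalent r (IntegralRep.empty 0) :=
    relations.sub_mem h IntegralRep.of_empty_mem_relations
  exact Nat.le_zero.mp (degree_le_of_equivalent h')

/-- The value of a `0`-dimensional representation with non-empty domain is the integrand at the
point (`ℝ⁰` carries the Dirac measure). [folklore] -/
theorem value_eq_of_dim_zero (s : IntegralRep 0) (hs : s.domain.Nonempty) :
    s.value = s.integrand default := by
  have hu : s.domain = univ := by
    obtain ⟨x, hx⟩ := hs
    exact eq_univ_of_forall fun y => by rwa [Subsingleton.elim y x]
  simp only [IntegralRep.value]
  rw [hu, Measure.restrict_univ, volume_pi,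
    Measure.pi_of_empty (fun _ : Fin 0 => (volume : Measure ℝ)) default, integral_dirac]

/-- A `0`-dimensional representation of value `0` is null: its integrand vanishes on the domain,
so integrand additivity `f = f + f` gives `−[s] ∈ relations`. [folklore] -/
theorem of_mem_relations_of_dim_zero {s : IntegralRep 0} (hs : s.value = 0) :
    of s ∈ relations := by
  have hf : EqOn s.integrand (s.integrand + s.integrand) s.domain := by
    intro x hx
    have hx0 : s.integrand x = 0 := by
      rw [Subsingleton.elim x default, ← value_eq_of_dim_zero s ⟨x, hx⟩, hs]
    simp [hx0]
  have h : of s - of s - of s ∈ integrandAddRel := ⟨0, s, s, s, rfl, rfl, hf, rfl⟩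
  have := relations.neg_mem (integrandAddRel_subset_relations h)
  simpa using this

/-- `[r] + [−r] ∈ relations`: with `Z` the zero representation on the domain of `r` (built
inline), integrand additivity gives `[Z] − [r] − [−r] ∈ relations` (`0 = f + (−f)`) and
`[Z] ∈ relations` (`0 = 0 + 0`). [folklore] -/
theorem of_add_of_neg_mem_relations (r : IntegralRep n) : of r + of r.neg ∈ relations := by
  let Z : IntegralRep n :=
    { domain := r.domain
      integrand := fun _ => 0
      isSemialgebraic_domain := r.isSemialgebraic_domain
      isSemialgebraicFunOn_integrand :=
        (isSemialgebraicFunOn_aeval r.isSemialgebraic_domain 0).congr fun _ _ => by simp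
      integrableOn := integrableOn_zero }
  have hZ3 : of Z - of Z - of Z ∈ integrandAddRel :=
    ⟨n, Z, Z, Z, rfl, rfl, fun x _ => by simp [Z], rfl⟩
  have hZ : of Z ∈ relations := by
    have := relations.neg_mem (integrandAddRel_subset_relations hZ3)
    simpa using this
  have h : of Z - of r - of r.neg ∈ integrandAddRel :=
    ⟨n, Z, r, r.neg, rfl, rfl, fun x _ => by simp [Z], rfl⟩
  have h1 := integrandAddRel_subset_relations h
  have : of r + of r.neg = of Z - (of Z - of r - of r.neg) := by abel
  rw [this]
  exact relations.sub_mem hZ h1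

/-! ## §2 The zero-symbol layer of `DegreeEquality` is faithfulness of `Ψ` -/

variable {k : Type} [Field k] [CharZero k]
  {P : Literature.AlgebraicGeometry.Motives.PeriodRealization k}
  {R : Literature.AlgebraicGeometry.Motives.RelativePeriodData P} {B : R.BoundaryData}
  {σ : k →+* ℂ}

/-! The **zero-symbol layer** of `DegreeEquality` for symbol data `Ψ` is the statement
`∀ ⦃n⦄ (r : IntegralRep n), noriSymbol Ψ (of r) = 0 → degree r = 0` (a representation whose Nori
symbol vanishes in `𝒫̃⁺` compresses to a point; `L(0) = 0` for any family of subspaces `C_k ∋ 0`).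
It is written out in full below (no auxiliary `def`, so that nothing here is a named fact). -/

/-- Faithful symbol data satisfy the zero-symbol layer. [folklore] -/
theorem zeroSymbolLayer_of_isFaithful {Ψ : NoriSymbolData R B σ} (h : Ψ.IsFaithful) :
    ∀ ⦃n : ℕ⦄ (r : IntegralRep n), noriSymbol Ψ (of r) = 0 → degree r = 0 :=
  fun _ r hr => degree_eq_zero_of_of_mem_relations (h (of r) hr)

/-- A representation with vanishing Nori symbol has value `0` (`eval = ev ∘ Ψ`). [folklore] -/
theorem value_eq_zero_of_noriSymbol_eq_zero (Ψ : NoriSymbolData R B σ) {r : IntegralRep n}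
    (h : noriSymbol Ψ (of r) = 0) : r.value = 0 := by
  have := eval_eq_of_noriSymbol_eq Ψ (c := of r) (c' := 0) (by rw [h, map_zero])
  simpa using this

/-- Under the zero-symbol layer, a representation with vanishing Nori symbol is NULL (not merely
of degree `0`): its `0`-dimensional witness has value `0`, hence is null. [folklore] -/
theorem of_mem_relations_of_noriSymbol_eq_zero {Ψ : NoriSymbolData R B σ}
    (hZ : ∀ ⦃n : ℕ⦄ (r : IntegralRep n), noriSymbol Ψ (of r) = 0 → degree r = 0)
    {r : IntegralRep n} (h : noriSymbol Ψ (of r) = 0) :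
    of r ∈ relations := by
  have hdeg : degree r = 0 := hZ r h
  have hR : Reachable r (degree r) := degree_spec r
  rw [hdeg] at hR
  obtain ⟨s, hs⟩ := hR
  have hval : s.value = 0 := by
    rw [← Equivalent.value_eq_holds hs]
    exact value_eq_zero_of_noriSymbol_eq_zero Ψ h
  have h0 : of s ∈ relations := of_mem_relations_of_dim_zero hval
  have : of r = (of r - of s) + of s := by abel
  rw [this]
  exact relations.add_mem hs h0

/-- Reduction used twice below: a formal combination with vanishing Nori symbol is, modulo the
moves, ONE representation `T` with vanishing Nori symbol (`c ≡ [r] − [r']`, merge `r ⊔ (−r')`).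
[folklore] -/
theorem exists_rep_of_noriSymbol_eq_zero (Ψ : NoriSymbolData R B σ) {c : FormalRep}
    (hc : noriSymbol Ψ c = 0) :
    ∃ (N : ℕ) (T : IntegralRep N), noriSymbol Ψ (of T) = 0 ∧ (of T ∈ relations → c ∈ relations) := by
  -- `c ≡ [r] − [r']` modulo the moves
  obtain ⟨n, m, r, r', hc'⟩ := exists_integralRep_sub_holds c
  -- merge `r` and `−r'` into one representation `T`: `[r] + [−r'] − [T] ∈ relations`
  obtain ⟨N, T, hT⟩ := r.exists_of_add_of_sub_of_mem_relations r'.neg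
  have hneg := of_add_of_neg_mem_relations r'
  have hΨ : ∀ x ∈ relations, noriSymbol Ψ x = 0 :=
    fun x hx => noriSymbol_eq_zero_of_mem_relations Ψ hx
  have h1 := hΨ _ hc'
  have h2 := hΨ _ hT
  have h3 := hΨ _ hneg
  simp only [map_sub, map_add] at h1 h2 h3
  have hT0 : noriSymbol Ψ (of T) = 0 := by
    have e2 : noriSymbol Ψ (of T) = noriSymbol Ψ (of r) + noriSymbol Ψ (of r'.neg) :=
      (sub_eq_zero.mp h2).symm
    have e1 : noriSymbol Ψ (of r) = noriSymbol Ψ (of r') := by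
      rw [hc, zero_sub, neg_eq_zero, sub_eq_zero] at h1
      exact h1
    have e3 : noriSymbol Ψ (of r'.neg) = -noriSymbol Ψ (of r') := eq_neg_of_add_eq_zero_right h3
    rw [e2, e3, e1, add_neg_cancel]
  refine ⟨N, T, hT0, fun hTrel => ?_⟩
  have hrr' : of r - of r' ∈ relations := by
    have : of r - of r' = (of r + of r'.neg - of T) + of T - (of r' + of r'.neg) := by abel
    rw [this]
    exact relations.sub_mem (relations.add_mem hT hTrel) hneg
  have : c = (c - (of r - of r')) + (of r - of r') := by abel
  rw [this]
  exact relations.add_mem hc' hrr'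

/-- **The zero-symbol layer of `DegreeEquality` is exactly faithfulness of the Nori symbol**
(`ker Ψ = KZ.relations`, thesis (b) of route VeryGoodTransfer), for the same symbol data `Ψ`.
[folklore] -/
theorem zeroSymbolLayer_iff_isFaithful (Ψ : NoriSymbolData R B σ) :
    (∀ ⦃n : ℕ⦄ (r : IntegralRep n), noriSymbol Ψ (of r) = 0 → degree r = 0) ↔ Ψ.IsFaithful := by
  refine ⟨fun hZ c hc => ?_, zeroSymbolLayer_of_isFaithful⟩
  obtain ⟨N, T, hT0, hTc⟩ := exists_rep_of_noriSymbol_eq_zero Ψ hc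
  exact hTc (of_mem_relations_of_noriSymbol_eq_zero hZ hT0)

/-! ### The repair "exclude the zero symbol" does not help: the layer at ANY `0`-dimensional symbol

Translating by the (Artin) symbol of a constant `p : IntegralRep 0` — "every `r` with `Ψ[r] = Ψ[p]`
compresses to a point" — is again equivalent to faithfulness: degree-`0` witnesses with the value
of `p ≠ 0` are literally `p`. -/

/-- Two integral representations with the same domain and the same integrand are equal. [folklore] -/
theorem integralRep_ext {s p : IntegralRep n} (hd : s.domain = p.domain)
    (hi : s.integrand = p.integrand) : s = p := by
  obtain ⟨d, i, a, b, e⟩ := s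
  obtain ⟨d', i', a', b', e'⟩ := p
  dsimp only at hd hi
  subst hd
  subst hi
  rfl

/-- A `0`-dimensional representation with non-zero value has domain `ℝ⁰ = {pt}`. [folklore] -/
theorem domain_eq_univ_of_value_ne_zero {s : IntegralRep 0} (h : s.value ≠ 0) : s.domain = univ := by
  rcases s.domain.eq_empty_or_nonempty with he | ⟨x, hx⟩
  · exact absurd (by simp [IntegralRep.value, he]) h
  · exact eq_univ_of_forall fun y => by rwa [Subsingleton.elim y x]

/-- Two `0`-dimensional representations with the same NON-ZERO value are equal. [folklore] -/
theorem eq_of_dim_zero_of_value_eq {s p : IntegralRep 0} (h : s.value = p.value) (hp : p.value ≠ 0) :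
    s = p := by
  have hs : s.value ≠ 0 := fun h0 => hp (h ▸ h0)
  have hsd := domain_eq_univ_of_value_ne_zero hs
  have hpd := domain_eq_univ_of_value_ne_zero hp
  have hsi : s.value = s.integrand default :=
    value_eq_of_dim_zero s (by rw [hsd]; exact univ_nonempty)
  have hpi : p.value = p.integrand default :=
    value_eq_of_dim_zero p (by rw [hpd]; exact univ_nonempty)
  refine integralRep_ext (hsd.trans hpd.symm) (funext fun x => ?_)
  rw [Subsingleton.elim x default, ← hsi, ← hpi, h]

/-- Faithfulness gives the layer at every `0`-dimensional symbol: `Ψ[r] = Ψ[p]`, `dim p = 0`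
`⇒ r ~ p ⇒ degree r = 0`. [folklore] -/
theorem pointLayer_of_isFaithful {Ψ : NoriSymbolData R B σ} (h : Ψ.IsFaithful) (p : IntegralRep 0) :
    ∀ ⦃n : ℕ⦄ (r : IntegralRep n), noriSymbol Ψ (of r) = noriSymbol Ψ (of p) → degree r = 0 :=
  fun _ r hr => Nat.le_zero.mp (degree_le_of_equivalent (h _ (by rw [map_sub, hr, sub_self])))

/-- **The layer at any `0`-dimensional symbol is again faithfulness.** For `p.value = 0` this is
the zero-symbol layer (`p` is null, `Ψ[p] = 0`); for `p.value ≠ 0` merge `T ⊔ p`, compress to a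
point `s`, and `s = p` (`eq_of_dim_zero_of_value_eq`). [folklore] -/
theorem pointLayer_iff_isFaithful (Ψ : NoriSymbolData R B σ) (p : IntegralRep 0) :
    (∀ ⦃n : ℕ⦄ (r : IntegralRep n), noriSymbol Ψ (of r) = noriSymbol Ψ (of p) → degree r = 0) ↔
      Ψ.IsFaithful := by
  refine ⟨fun hL => ?_, fun h => pointLayer_of_isFaithful h p⟩
  by_cases hp : p.value = 0
  · have hp0 : noriSymbol Ψ (of p) = 0 :=
      noriSymbol_eq_zero_of_mem_relations Ψ (of_mem_relations_of_dim_zero hp)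
    refine (zeroSymbolLayer_iff_isFaithful Ψ).mp fun n r hr => hL r ?_
    rw [hr, hp0]
  · intro c hc
    obtain ⟨N, T, hT0, hTc⟩ := exists_rep_of_noriSymbol_eq_zero Ψ hc
    apply hTc
    -- merge `T` and `p`: `[T] + [p] − [T'] ∈ relations`, so `Ψ[T'] = Ψ[p]`
    obtain ⟨N', T', hT'⟩ := T.exists_of_add_of_sub_of_mem_relations p
    have h2 := noriSymbol_eq_zero_of_mem_relations Ψ hT'
    simp only [map_sub, map_add] at h2
    have hΨT' : noriSymbol Ψ (of T') = noriSymbol Ψ (of p) := by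
      rw [hT0, zero_add, sub_eq_zero] at h2
      exact h2.symm
    have hdeg : degree T' = 0 := hL T' hΨT'
    have hR : Reachable T' (degree T') := degree_spec T'
    rw [hdeg] at hR
    obtain ⟨s, hs⟩ := hR
    have hval : s.value = p.value := by
      rw [← Equivalent.value_eq_holds hs]
      have := eval_eq_of_noriSymbol_eq Ψ hΨT'
      simpa using this
    have hsp : s = p := eq_of_dim_zero_of_value_eq hval hp
    rw [hsp] at hs
    have : of T = (of T + of p - of T') + (of T' - of p) := by abel
    rw [this]
    exact relations.add_mem hT' hs

/-! ## §3 The sandwich: summit ⇒ zero layer ⇒ (summit, given the formal period conjecture) -/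

/-- The kernel form of Conjecture 1 makes every Nori symbol data faithful. [folklore] -/
theorem isFaithful_of_kzKernelConjecture (h : KZKernelConjecture) (Ψ : NoriSymbolData R B σ) :
    Ψ.IsFaithful :=
  fun c hc => h c (by
    have := eval_eq_of_noriSymbol_eq Ψ (c := c) (c' := 0) (by rw [hc, map_zero])
    simpa using this)

/-- **Summit ⇒ zero-symbol layer** (for every symbol data, over every period datum). [folklore] -/
theorem zeroSymbolLayer_of_summit (h : _root_.KontsevichZagierPeriods) (Ψ : NoriSymbolData R B σ) :
    ∀ ⦃n : ℕ⦄ (r : IntegralRep n), noriSymbol Ψ (of r) = 0 → degree r = 0 :=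
  zeroSymbolLayer_of_isFaithful
    (isFaithful_of_kzKernelConjecture (kzKernelConjecture_iff_isRational.mpr h) Ψ)

/-- **Zero-symbol layer + Kontsevich's formal period conjecture ⇒ summit.** [folklore] -/
theorem summit_of_zeroSymbolLayer (Ψ : NoriSymbolData R B σ)
    (hZ : ∀ ⦃n : ℕ⦄ (r : IntegralRep n), noriSymbol Ψ (of r) = 0 → degree r = 0)
    (hinj : FormalPeriodEvalInjective R B σ) : _root_.KontsevichZagierPeriods :=
  kzKernelConjecture_iff_isRational.mp fun c hc =>
    kernel_subset_relations_of_isFaithful Ψ hinj ((zeroSymbolLayer_iff_isFaithful Ψ).mp hZ) c hc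

end Summit.KontsevichZagierPeriods.Theorems.DegreeEquality.Negative

end
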